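import Mathlib.Algebra.MvPolynomial.Derivation
import Mathlib.Algebra.MvPolynomial.Eval
import Mathlib.Analysis.Calculus.IteratedDeriv.Lemmas
import Mathlib.Analysis.Calculus.Deriv.Mul
import HarnessLib

/-!
# Jets of polynomials in the solutions of a polynomial ODE system

Topic: `Literature/NumberTheory/Transcendental`. Plan item W4b of the unit
`provefact-Literature.NumberTheory.Transcendental.H-b596640137` (fact
`Literature.NumberTheory.Transcendental.HuberWustholzOnePeriods`): the algebraic core of the
"differential operators act on the coordinate ring by polynomial formulas" step of Baker's method
(Baker–Wüstholz 2007, §6.7, pp. 112–113; Baker 1975, Ch. 2, p. 21 "the partial derivatives … are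
again polynomials in the same functions"), in one variable.

**Setting.** `g : 𝕜 → (ι → 𝕜)` is a family of functions on a field `𝕜` (`ℝ` or `ℂ`) which on an
open set `U` solves the polynomial system `(gᵢ)′(ξ) = Qᵢ(g(ξ))`, `Qᵢ ∈ 𝕜[Xᵢ : i ∈ ι]`. Let `D` be
the `𝕜`-derivation of `𝕜[X]` with `D(Xᵢ) = Qᵢ` (`MvPolynomial.mkDerivation`). Then for every
polynomial `H`:

* `hasDerivAt_eval_of_ode` — `(H ∘ g)′(ξ) = (D H)(g(ξ))` on `U` (chain rule = Leibniz rule);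
* `iteratedDeriv_eval_of_ode` — `(H ∘ g)⁽ᵏ⁾(ξ) = (Dᵏ H)(g(ξ))` on `U` for all `k`.

So the jets of `H ∘ g` at a point `ξ₀ ∈ U` are the values at `g(ξ₀)` of the explicit polynomials
`Dᵏ H` — if `g(ξ₀)` has algebraic coordinates and `Qᵢ, H` algebraic coefficients, the jets are
algebraic, with degrees and heights controlled by those of `Dᵏ H` (used for the Siegel step and the
Liouville step of Baker's method on `M_κ`, where `g` = chart coordinates along a line in `Lie M_κ`,
`UnivExtChartLattice.lean`). Everything here is proved; no analytic input beyond the chain rule.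

## References

* A. Baker, G. Wüstholz, *Logarithmic Forms and Diophantine Geometry*, CUP 2007, §6.7.
* A. Baker, *Transcendental Number Theory*, CUP 1975, Ch. 2, §3 (closed form of the derivatives of
  the auxiliary function).
-/

noncomputable section

open MvPolynomial Filter Topology

namespace Literature.NumberTheory.Transcendental

namespace PolyODE

variable {𝕜 : Type*} [NontriviallyNormedField 𝕜] {ι : Type*}

/-- The derivation `D` of `𝕜[X]` attached to the system `Xᵢ′ = Qᵢ(X)`: `D Xᵢ = Qᵢ`, extended by the
Leibniz rule. [folklore] -/
def der (Q : ι → MvPolynomial ι 𝕜) : Derivation 𝕜 (MvPolynomial ι 𝕜) (MvPolynomial ι 𝕜) :=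
  MvPolynomial.mkDerivation 𝕜 Q

/-- `D Xᵢ = Qᵢ`. [folklore] -/
@[simp] theorem der_X (Q : ι → MvPolynomial ι 𝕜) (i : ι) : der Q (X i) = Q i :=
  MvPolynomial.mkDerivation_X 𝕜 Q i

/-- `D (C a) = 0`. [folklore] -/
@[simp] theorem der_C (Q : ι → MvPolynomial ι 𝕜) (a : 𝕜) : der Q (C a) = 0 :=
  MvPolynomial.derivation_C _ a

/-- **Chain rule = Leibniz rule.** If `gᵢ` has derivative `Qᵢ(g(ξ))` at `ξ` for every `i`, then
`ξ ↦ H(g(ξ))` has derivative `(D H)(g(ξ))` at `ξ`, for every polynomial `H`. [folklore] -/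
theorem hasDerivAt_eval_of_ode (Q : ι → MvPolynomial ι 𝕜) {g : 𝕜 → ι → 𝕜} {ξ : 𝕜}
    (hg : ∀ i, HasDerivAt (fun ξ => g ξ i) (eval (g ξ) (Q i)) ξ) (H : MvPolynomial ι 𝕜) :
    HasDerivAt (fun ξ => eval (g ξ) H) (eval (g ξ) (der Q H)) ξ := by
  induction H using MvPolynomial.induction_on with
  | C a =>
    simpa using hasDerivAt_const ξ (a : 𝕜)
  | add p q hp hq =>
    have h := hp.add hq
    simp only [map_add]
    exact h
  | mul_X p i hp =>
    have h := hp.mul (hg i)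
    have e : (fun ξ => eval (g ξ) (p * X i)) = fun ξ => eval (g ξ) p * g ξ i := by
      funext ξ; simp
    rw [e]
    refine h.congr_deriv ?_
    simp only [der, Derivation.leibniz, MvPolynomial.mkDerivation_X, smul_eq_mul, map_add, map_mul,
      eval_X]
    ring

/-- On an open set where the system holds, `ξ ↦ H(g(ξ))` is differentiable with derivative
`(D H) ∘ g`, as an identity of functions near each point. [folklore] -/
theorem deriv_eval_eventuallyEq_of_ode (Q : ι → MvPolynomial ι 𝕜) {g : 𝕜 → ι → 𝕜} {U : Set 𝕜}
    (hU : IsOpen U) (hg : ∀ ξ ∈ U, ∀ i, HasDerivAt (fun ξ => g ξ i) (eval (g ξ) (Q i)) ξ)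
    (H : MvPolynomial ι 𝕜) {ξ₀ : 𝕜} (h₀ : ξ₀ ∈ U) :
    deriv (fun ξ => eval (g ξ) H) =ᶠ[𝓝 ξ₀] fun ξ => eval (g ξ) (der Q H) := by
  filter_upwards [hU.mem_nhds h₀] with ξ hξ
  exact (hasDerivAt_eval_of_ode Q (hg ξ hξ) H).deriv

/-- **Jets of `H ∘ g` are values of `Dᵏ H`.** On an open set `U` where `(gᵢ)′ = Qᵢ(g)`, for every
polynomial `H`, every `k` and every `ξ ∈ U`: `(H ∘ g)⁽ᵏ⁾(ξ) = (Dᵏ H)(g(ξ))`. [folklore] -/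
theorem iteratedDeriv_eval_of_ode (Q : ι → MvPolynomial ι 𝕜) {g : 𝕜 → ι → 𝕜} {U : Set 𝕜}
    (hU : IsOpen U) (hg : ∀ ξ ∈ U, ∀ i, HasDerivAt (fun ξ => g ξ i) (eval (g ξ) (Q i)) ξ)
    (k : ℕ) : ∀ (H : MvPolynomial ι 𝕜), ∀ ξ ∈ U,
      iteratedDeriv k (fun ξ => eval (g ξ) H) ξ = eval (g ξ) ((der Q)^[k] H) := by
  induction k with
  | zero => intro H ξ _; simp
  | succ k ih =>
    intro H ξ hξ
    rw [iteratedDeriv_succ, Function.iterate_succ_apply']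
    -- near `ξ`, the `k`-th jet is `(Dᵏ H) ∘ g`
    have hloc : iteratedDeriv k (fun ξ => eval (g ξ) H) =ᶠ[𝓝 ξ]
        fun ξ => eval (g ξ) ((der Q)^[k] H) := by
      filter_upwards [hU.mem_nhds hξ] with ζ hζ using ih H ζ hζ
    rw [hloc.deriv_eq]
    exact (hasDerivAt_eval_of_ode Q (hg ξ hξ) ((der Q)^[k] H)).deriv

/-- In particular the vanishing of the jets of `H ∘ g` below order `N` at `ξ ∈ U` is the vanishing
of the NUMBERS `(Dᵏ H)(g(ξ))`, `k < N`. [folklore] -/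
theorem iteratedDeriv_eval_eq_zero_iff_of_ode (Q : ι → MvPolynomial ι 𝕜) {g : 𝕜 → ι → 𝕜}
    {U : Set 𝕜} (hU : IsOpen U)
    (hg : ∀ ξ ∈ U, ∀ i, HasDerivAt (fun ξ => g ξ i) (eval (g ξ) (Q i)) ξ) (H : MvPolynomial ι 𝕜)
    {ξ : 𝕜} (hξ : ξ ∈ U) (N : ℕ) :
    (∀ k < N, iteratedDeriv k (fun ξ => eval (g ξ) H) ξ = 0) ↔
      ∀ k < N, eval (g ξ) ((der Q)^[k] H) = 0 := by
  refine forall₂_congr fun k _ => ?_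
  rw [iteratedDeriv_eval_of_ode Q hU hg k H ξ hξ]

/-! ### Systems with a parameter: restriction to a line -/

/-- **Restriction to a line.** If the coordinates `A : E → (ι → 𝕜)` of a chart satisfy, along the
affine line `ξ ↦ w + ξ • x`, the system `(Aᵢ(w + ξx))′ = Qᵢˣ(A(w + ξx))` on an open set of
parameters, the jets of `H(A(w + ξx))` at `ξ` are the values `(Dᵏ H)(A(w + ξx))` with `D Xᵢ = Qᵢˣ`
(this is `iteratedDeriv_eval_of_ode` for `g ξ = A (w + ξ • x)`; stated separately because it is the
form consumed by `GaGmE.Std.VanishesAlong`). [folklore] -/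
theorem iteratedDeriv_eval_line {E : Type*} [AddCommGroup E] [Module 𝕜 E]
    (Q : ι → MvPolynomial ι 𝕜) (A : E → ι → 𝕜) (w x : E) {U : Set 𝕜} (hU : IsOpen U)
    (hA : ∀ ξ ∈ U, ∀ i, HasDerivAt (fun ξ => A (w + ξ • x) i) (eval (A (w + ξ • x)) (Q i)) ξ)
    (H : MvPolynomial ι 𝕜) (k : ℕ) {ξ : 𝕜} (hξ : ξ ∈ U) :
    iteratedDeriv k (fun ξ => eval (A (w + ξ • x)) H) ξ = eval (A (w + ξ • x)) ((der Q)^[k] H) :=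
  iteratedDeriv_eval_of_ode Q (g := fun ξ => A (w + ξ • x)) hU hA k H ξ hξ

end PolyODE

end Literature.NumberTheory.Transcendental

end
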